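import Summits.BirchSwinnertonDyer.BirchSwinnertonDyer.Theses.PrintCf2
import Summits.BirchSwinnertonDyer.BirchSwinnertonDyer.Theorems.PrintCf2DisegniPairTwoCanonicalCycPin
import HarnessLib

/-!
# Route PrintCf2 — aside `IsCanonicalCycPairingEqMinusTwist` (stmt-BirchSwinnertonDyer-27618) CLOSED BY NAME

Cell `bsd-print-cf2` (D-0131 (2) PRINT TIER, leaf CornerF @ `p = 2`), width seat `bsd-line-cf2-p1-w8` g27,
deliverable (B3) of the planner's SUMMON `wake/SUMMON-bsd-line-cf2-p1-w8-20260831T031655Z.md`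
(«PIN THEOREM IN, MISSTATED PROP OUT»).

The aside was RESTATED (route A rev 65, item 27618 replacing 27316) from the literal all-`(V, p, d)`
Literature Prop `WeierstrassCurve.isCanonicalCyc_pairing_eq_minusTwist` (junk branches; -w8 g26 evidence
`PIN-THEOREM-27316-w8g26.md`) to C′ = the exact statement of the landed tree theorem
`PrintCf2.DisegniPairTwo.pairing_eq_minusTwist_pairing_of_pair` (p805565, -w8 g26): the PIN with factor ONE
at `p = 2` — for `V/ℚ` elliptic, `ℤ`-integral with `V ⊗ ℚ₂` `ℤ₂`-integral carrying a Mazur–Tate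
sigma-squared pair, `d ∈ {−1, 2, −2}`, `H` a number field, `DH` on `V(H)` canonical cyclotomic and `Dc` on
`V^{(d)}(ℚ)` canonical Sq-minus-twist, `⟨P′,P′⟩_{DH} = ⟨P,P⟩_{Dc}` for `P = (X, Y) ∈ V^{(d)}(ℚ)` and any
`H`-point `P′ = (x′, y′)` of `V` with `x′ = X/d`. This file is the one-line by-name closer. A TREE THEOREM
(trust base empty: std axioms, no named fact), NOT print; beyond-print theorem: yes (it is not a printed
statement), but an aside — no count effect. BSD is not proved by any of this; the crux
stmt-BirchSwinnertonDyer-20368 is NOT closed here; no summit statement is proved by this seat.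
[cite: MazurSteinTate2006, §2.8] [cite: Disegni2017, §4.1.1 (4.1.7)–(4.1.8)]
-/

-- single-conjunct summit: `Summit.BirchSwinnertonDyer.BirchSwinnertonDyer.…` repeats the name by design
set_option linter.dupNamespace false

namespace Summit.BirchSwinnertonDyer.BirchSwinnertonDyer.Theorems.PrintCf2

/-- **Item `IsCanonicalCycPairingEqMinusTwist` (stmt-BirchSwinnertonDyer-27618) holds**: the restated aside
IS the statement of `PrintCf2.DisegniPairTwo.pairing_eq_minusTwist_pairing_of_pair` (the canonical
cyclotomic `2`-adic `H`-datum at an `H`-point above `X/d` equals the canonical minus-twist `ℚ`-datum at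
`(X, Y)`, factor one, `d ∈ {−1, 2, −2}`). [cite: MazurSteinTate2006, §2.8]
[cite: Disegni2017, §4.1.1 (4.1.7)–(4.1.8)] -/
theorem isCanonicalCycPairingEqMinusTwist_proof :
    Summit.BirchSwinnertonDyer.BirchSwinnertonDyer.Theses.PrintCf2.IsCanonicalCycPairingEqMinusTwist := by
  unfold Summit.BirchSwinnertonDyer.BirchSwinnertonDyer.Theses.PrintCf2.IsCanonicalCycPairingEqMinusTwist
  intro V _ _ _ H _ _ hpair d hd _ DH Dc hDH hDc X Y hP x' y' hP' hx
  exact DisegniPairTwo.pairing_eq_minusTwist_pairing_of_pair V H hpair hd DH Dc hDH hDc hP hP' hx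

end Summit.BirchSwinnertonDyer.BirchSwinnertonDyer.Theorems.PrintCf2
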